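import Literature.NumberTheory.EllipticCurves.FormalGroupLawChordFormulaProofs
import Literature.NumberTheory.EllipticCurves.FormalGroupLawAxiomsUniversalProofs
import Literature.NumberTheory.EllipticCurves.FormalGroupMultiplicationUniversalProofs
import Mathlib.Algebra.MvPolynomial.Funext
import HarnessLib

/-!
# The chord and duplication identities of the formal group hold over EVERY commutative ring
# (Silverman AEC III.2.3 with IV.1–IV.2; proofs only)

`Proofs`-style file (THEOREMS ONLY: no definition, no named fact, no instance), topic `NumberTheory/EllipticCurves`.
The four power-series identities of `FormalGroupLawChordFormulaProofs` — "the formal group law computes the chord and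
the tangent, poles cleared": `formalXMulSq_formalGroupLaw_chord`, `…_chordY`, `formalXMulSq_formalMul_two`, `…_twoY` —
are stated there for a Weierstrass equation over `ℤ_p` with elliptic generic fibre (they were proved from the
`ℚ_p`-points of `E₁` by the identity theorem). They are identities in `ℤ[a₁,…,a₆]⟦u, v⟧` and therefore hold for every
Weierstrass equation over every commutative ring (AEC IV.1: "power series with coefficients in `ℤ[a₁,…,a₆]`"). Proof
(`mvPowerSeries_universalInt_eq_zero`): for the universal equation over `ℤ[aᵢ] = MvPolynomial (Fin 5) ℤ` each
coefficient of the defect is an integer polynomial in the `aᵢ`; at every `a ∈ ℤ⁵` with `Δ(a) ≠ 0` it vanishes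
(the `ℤ_2`-version pulled back along `ℤ ↪ ℤ_2`), so `coefficient × Δ` vanishes on `ℤ⁵`, hence is `0`
(`MvPolynomial.funext`), hence the coefficient is `0` (`Δ ≠ 0` in the domain `ℤ[aᵢ]`); then specialise along
`ℤ[aᵢ] → R` (`universalInt_map`). Primed names = ring-general versions with literally the same two sides.

These identities are what makes `t ↦ (X(t)/t², −X(t)/t³)` a homomorphism `Ŵ(𝔪_K) → E₁(K)` for an arbitrary integral
equation over an arbitrary complete field (AEC VII.2.2; sequel `FormalGroupNilIdealPoints*`).

## References
* J. H. Silverman, *The Arithmetic of Elliptic Curves* (2009), III.2.3, IV.1–IV.2. [SilvermanAEC2009]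
-/

noncomputable section

open PowerSeries Literature.NumberTheory.EllipticCurves

namespace WeierstrassCurve

/-! ### The density principle for the universal equation -/

section Universal

/-- `Δ` of the universal equation specialises: `ev_a(Δ_U) = Δ(U ⊗ ev_a)`. [folklore] -/
private theorem eval_Δ_universalInt (a : Fin 5 → ℤ) :
    MvPolynomial.eval a universalInt.Δ = (universalInt.map (MvPolynomial.eval a)).Δ := by
  rw [map_Δ]

/-- The universal discriminant is not zero (`y² = x³ + 1` has `Δ = -432`). [cite: SilvermanAEC2009, III.1] -/
theorem Δ_universalInt_ne_zero : universalInt.Δ ≠ 0 := by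
  intro h
  have h1 := eval_Δ_universalInt ![0, 0, 0, 0, 1]
  rw [h, map_zero] at h1
  have h2 : (universalInt.map (MvPolynomial.eval ![(0 : ℤ), 0, 0, 0, 1])).Δ = -432 := by
    simp [universalInt, WeierstrassCurve.map, WeierstrassCurve.Δ, WeierstrassCurve.b₂, WeierstrassCurve.b₄,
      WeierstrassCurve.b₆, WeierstrassCurve.b₈]
  omega

/-- **Density principle**: a power series over `ℤ[a₁,…,a₆]` all of whose specialisations at integer points with
non-zero discriminant vanish is zero (each coefficient times `Δ` is an integer polynomial vanishing on `ℤ⁵`,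
`MvPolynomial.funext`, and `Δ ≠ 0` in the domain `ℤ[aᵢ]`) — the principle behind AEC IV.1's "power series with
coefficients in `ℤ[a₁,…,a₆]`". [cite: SilvermanAEC2009, IV.1] -/
theorem mvPowerSeries_universalInt_eq_zero {σ : Type*} (G : MvPowerSeries σ (MvPolynomial (Fin 5) ℤ))
    (h : ∀ a : Fin 5 → ℤ, (universalInt.map (MvPolynomial.eval a)).Δ ≠ 0 →
      MvPowerSeries.map (MvPolynomial.eval a) G = 0) : G = 0 := by
  refine MvPowerSeries.ext fun d => ?_
  rw [MvPowerSeries.coeff_zero]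
  have key : MvPowerSeries.coeff d G * universalInt.Δ = 0 := by
    apply MvPolynomial.funext
    intro a
    rw [map_mul, map_zero, eval_Δ_universalInt]
    by_cases ha : (universalInt.map (MvPolynomial.eval a)).Δ = 0
    · rw [ha, mul_zero]
    · have hc := congrArg (MvPowerSeries.coeff d) (h a ha)
      rw [MvPowerSeries.coeff_map, map_zero] at hc
      rw [hc, zero_mul]
  exact (mul_eq_zero.mp key).resolve_right Δ_universalInt_ne_zero

variable {R : Type*} [CommRing R] (W : WeierstrassCurve R)

/-- `ev_W(a₁) = a₁`, …: the universal evaluation on the universal coefficients (every equation is a specialisation of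
the universal one). [cite: SilvermanAEC2009, IV.1] -/
@[simp] theorem universalEval_a :
    W.universalEval universalInt.a₁ = W.a₁ ∧ W.universalEval universalInt.a₂ = W.a₂ ∧
      W.universalEval universalInt.a₃ = W.a₃ ∧ W.universalEval universalInt.a₄ = W.a₄ ∧
      W.universalEval universalInt.a₆ = W.a₆ := by
  simp [universalEval, universalInt]

/-- `PowerSeries` form of the density principle. [cite: SilvermanAEC2009, IV.1] -/
theorem powerSeries_universalInt_eq_zero (G : PowerSeries (MvPolynomial (Fin 5) ℤ))
    (h : ∀ a : Fin 5 → ℤ, (universalInt.map (MvPolynomial.eval a)).Δ ≠ 0 →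
      PowerSeries.map (MvPolynomial.eval a) G = 0) : G = 0 :=
  mvPowerSeries_universalInt_eq_zero G h

/-- `ℤ⟦X⟧ → ℤ_2⟦X⟧` is injective. [folklore] -/
private theorem powerSeries_map_injective_int2 : Function.Injective (PowerSeries.map (Int.castRingHom ℤ_[2])) :=
  fun _ _ h => mvPowerSeries_map_injective (σ := Unit) (RingHom.injective_int _) h

/-- An integral equation with `Δ ≠ 0` has elliptic generic fibre over `ℚ_2` after `ℤ ↪ ℤ_2`. [folklore] -/
private theorem isElliptic_map_int_padic (W₀ : WeierstrassCurve ℤ) (hΔ : W₀.Δ ≠ 0) :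
    ((W₀.map (Int.castRingHom ℤ_[2])).map PadicInt.Coe.ringHom).IsElliptic := by
  refine ⟨?_⟩
  rw [map_Δ, map_Δ, isUnit_iff_ne_zero]
  simpa using hΔ

end Universal

/-! ### `formalXMulSq_formalGroupLaw_chord` over every ring -/

section
variable {R : Type*} [CommRing R] (W : WeierstrassCurve R)

/-- Over `ℤ` with `Δ ≠ 0` (pull back the `ℤ_2`-identity along `ℤ ↪ ℤ_2`). [cite: SilvermanAEC2009, IV.1] -/
private theorem formalXMulSq_formalGroupLaw_chord_int (W₀ : WeierstrassCurve ℤ) (hΔ : W₀.Δ ≠ 0) :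
    W₀.formalXMulSq.subst W₀.formalGroupLaw *
        (W₀.formalXMulSq.subst (MvPowerSeries.X 0 : MvPowerSeries (Fin 2) ℤ) *
              (MvPowerSeries.X 1 : MvPowerSeries (Fin 2) ℤ) ^ 2 -
            W₀.formalXMulSq.subst (MvPowerSeries.X 1 : MvPowerSeries (Fin 2) ℤ) *
              (MvPowerSeries.X 0 : MvPowerSeries (Fin 2) ℤ) ^ 2) ^ 2 *
        (MvPowerSeries.X 0 : MvPowerSeries (Fin 2) ℤ) ^ 2 *
        (MvPowerSeries.X 1 : MvPowerSeries (Fin 2) ℤ) ^ 2 =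
      W₀.formalGroupLaw ^ 2 *
        ((W₀.formalXMulSq.subst (MvPowerSeries.X 1 : MvPowerSeries (Fin 2) ℤ) *
                (MvPowerSeries.X 0 : MvPowerSeries (Fin 2) ℤ) ^ 3 -
              W₀.formalXMulSq.subst (MvPowerSeries.X 0 : MvPowerSeries (Fin 2) ℤ) *
                (MvPowerSeries.X 1 : MvPowerSeries (Fin 2) ℤ) ^ 3) ^ 2 +
            MvPowerSeries.C W₀.a₁ *
              (W₀.formalXMulSq.subst (MvPowerSeries.X 1 : MvPowerSeries (Fin 2) ℤ) *
                  (MvPowerSeries.X 0 : MvPowerSeries (Fin 2) ℤ) ^ 3 -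
                W₀.formalXMulSq.subst (MvPowerSeries.X 0 : MvPowerSeries (Fin 2) ℤ) *
                  (MvPowerSeries.X 1 : MvPowerSeries (Fin 2) ℤ) ^ 3) *
              (W₀.formalXMulSq.subst (MvPowerSeries.X 0 : MvPowerSeries (Fin 2) ℤ) *
                  (MvPowerSeries.X 1 : MvPowerSeries (Fin 2) ℤ) ^ 2 -
                W₀.formalXMulSq.subst (MvPowerSeries.X 1 : MvPowerSeries (Fin 2) ℤ) *
                  (MvPowerSeries.X 0 : MvPowerSeries (Fin 2) ℤ) ^ 2) *
              (MvPowerSeries.X 0 : MvPowerSeries (Fin 2) ℤ) *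
              (MvPowerSeries.X 1 : MvPowerSeries (Fin 2) ℤ) -
          (MvPowerSeries.C W₀.a₂ * (MvPowerSeries.X 0 : MvPowerSeries (Fin 2) ℤ) ^ 2 *
                (MvPowerSeries.X 1 : MvPowerSeries (Fin 2) ℤ) ^ 2 +
              W₀.formalXMulSq.subst (MvPowerSeries.X 0 : MvPowerSeries (Fin 2) ℤ) *
                (MvPowerSeries.X 1 : MvPowerSeries (Fin 2) ℤ) ^ 2 +
              W₀.formalXMulSq.subst (MvPowerSeries.X 1 : MvPowerSeries (Fin 2) ℤ) *
                (MvPowerSeries.X 0 : MvPowerSeries (Fin 2) ℤ) ^ 2) *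
            (W₀.formalXMulSq.subst (MvPowerSeries.X 0 : MvPowerSeries (Fin 2) ℤ) *
                  (MvPowerSeries.X 1 : MvPowerSeries (Fin 2) ℤ) ^ 2 -
                W₀.formalXMulSq.subst (MvPowerSeries.X 1 : MvPowerSeries (Fin 2) ℤ) *
                  (MvPowerSeries.X 0 : MvPowerSeries (Fin 2) ℤ) ^ 2) ^ 2) := by
  haveI := isElliptic_map_int_padic W₀ hΔ
  have h2 := (W₀.map (Int.castRingHom ℤ_[2])).formalXMulSq_formalGroupLaw_chord
  apply mvPowerSeries_map_injective (σ := Fin 2) (φ := Int.castRingHom ℤ_[2]) (RingHom.injective_int _)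
  simp only [map_mul, map_pow, map_add, map_sub, MvPowerSeries.map_X, MvPowerSeries.map_C,
      PowerSeries.map_subst (PowerSeries.HasSubst.X _), PowerSeries.map_subst (WeierstrassCurve.hasSubst_formalGroupLaw _),
      map_formalXMulSq, map_formalGroupLaw, map_a₁, map_a₂] at h2 ⊢
  exact h2

/-- The universal case. [cite: SilvermanAEC2009, IV.1] -/
private theorem formalXMulSq_formalGroupLaw_chord_universalInt :
    universalInt.formalXMulSq.subst universalInt.formalGroupLaw *
        (universalInt.formalXMulSq.subst (MvPowerSeries.X 0 : MvPowerSeries (Fin 2) (MvPolynomial (Fin 5) ℤ)) *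
              (MvPowerSeries.X 1 : MvPowerSeries (Fin 2) (MvPolynomial (Fin 5) ℤ)) ^ 2 -
            universalInt.formalXMulSq.subst (MvPowerSeries.X 1 : MvPowerSeries (Fin 2) (MvPolynomial (Fin 5) ℤ)) *
              (MvPowerSeries.X 0 : MvPowerSeries (Fin 2) (MvPolynomial (Fin 5) ℤ)) ^ 2) ^ 2 *
        (MvPowerSeries.X 0 : MvPowerSeries (Fin 2) (MvPolynomial (Fin 5) ℤ)) ^ 2 *
        (MvPowerSeries.X 1 : MvPowerSeries (Fin 2) (MvPolynomial (Fin 5) ℤ)) ^ 2 =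
      universalInt.formalGroupLaw ^ 2 *
        ((universalInt.formalXMulSq.subst (MvPowerSeries.X 1 : MvPowerSeries (Fin 2) (MvPolynomial (Fin 5) ℤ)) *
                (MvPowerSeries.X 0 : MvPowerSeries (Fin 2) (MvPolynomial (Fin 5) ℤ)) ^ 3 -
              universalInt.formalXMulSq.subst (MvPowerSeries.X 0 : MvPowerSeries (Fin 2) (MvPolynomial (Fin 5) ℤ)) *
                (MvPowerSeries.X 1 : MvPowerSeries (Fin 2) (MvPolynomial (Fin 5) ℤ)) ^ 3) ^ 2 +
            MvPowerSeries.C universalInt.a₁ *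
              (universalInt.formalXMulSq.subst (MvPowerSeries.X 1 : MvPowerSeries (Fin 2) (MvPolynomial (Fin 5) ℤ)) *
                  (MvPowerSeries.X 0 : MvPowerSeries (Fin 2) (MvPolynomial (Fin 5) ℤ)) ^ 3 -
                universalInt.formalXMulSq.subst (MvPowerSeries.X 0 : MvPowerSeries (Fin 2) (MvPolynomial (Fin 5) ℤ)) *
                  (MvPowerSeries.X 1 : MvPowerSeries (Fin 2) (MvPolynomial (Fin 5) ℤ)) ^ 3) *
              (universalInt.formalXMulSq.subst (MvPowerSeries.X 0 : MvPowerSeries (Fin 2) (MvPolynomial (Fin 5) ℤ)) *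
                  (MvPowerSeries.X 1 : MvPowerSeries (Fin 2) (MvPolynomial (Fin 5) ℤ)) ^ 2 -
                universalInt.formalXMulSq.subst (MvPowerSeries.X 1 : MvPowerSeries (Fin 2) (MvPolynomial (Fin 5) ℤ)) *
                  (MvPowerSeries.X 0 : MvPowerSeries (Fin 2) (MvPolynomial (Fin 5) ℤ)) ^ 2) *
              (MvPowerSeries.X 0 : MvPowerSeries (Fin 2) (MvPolynomial (Fin 5) ℤ)) *
              (MvPowerSeries.X 1 : MvPowerSeries (Fin 2) (MvPolynomial (Fin 5) ℤ)) -
          (MvPowerSeries.C universalInt.a₂ * (MvPowerSeries.X 0 : MvPowerSeries (Fin 2) (MvPolynomial (Fin 5) ℤ)) ^ 2 *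
                (MvPowerSeries.X 1 : MvPowerSeries (Fin 2) (MvPolynomial (Fin 5) ℤ)) ^ 2 +
              universalInt.formalXMulSq.subst (MvPowerSeries.X 0 : MvPowerSeries (Fin 2) (MvPolynomial (Fin 5) ℤ)) *
                (MvPowerSeries.X 1 : MvPowerSeries (Fin 2) (MvPolynomial (Fin 5) ℤ)) ^ 2 +
              universalInt.formalXMulSq.subst (MvPowerSeries.X 1 : MvPowerSeries (Fin 2) (MvPolynomial (Fin 5) ℤ)) *
                (MvPowerSeries.X 0 : MvPowerSeries (Fin 2) (MvPolynomial (Fin 5) ℤ)) ^ 2) *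
            (universalInt.formalXMulSq.subst (MvPowerSeries.X 0 : MvPowerSeries (Fin 2) (MvPolynomial (Fin 5) ℤ)) *
                  (MvPowerSeries.X 1 : MvPowerSeries (Fin 2) (MvPolynomial (Fin 5) ℤ)) ^ 2 -
                universalInt.formalXMulSq.subst (MvPowerSeries.X 1 : MvPowerSeries (Fin 2) (MvPolynomial (Fin 5) ℤ)) *
                  (MvPowerSeries.X 0 : MvPowerSeries (Fin 2) (MvPolynomial (Fin 5) ℤ)) ^ 2) ^ 2) := by
  rw [← sub_eq_zero]
  refine mvPowerSeries_universalInt_eq_zero _ fun a ha => ?_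
  rw [map_sub, sub_eq_zero]
  have h := formalXMulSq_formalGroupLaw_chord_int (universalInt.map (MvPolynomial.eval a)) ha
  simp only [map_mul, map_pow, map_add, map_sub, MvPowerSeries.map_X, MvPowerSeries.map_C,
      PowerSeries.map_subst (PowerSeries.HasSubst.X _), PowerSeries.map_subst (WeierstrassCurve.hasSubst_formalGroupLaw _),
      map_formalXMulSq, map_formalGroupLaw, map_a₁, map_a₂] at h ⊢
  exact h

/-- **`x(u +_F v)` formally, over EVERY commutative ring**: `X(F)·N²·u²v² = F²·(M² + a₁MNuv − (a₂u²v² + X₀v² + X₁u²)·N²)` (notation of `FormalGroupLawChordFormulaProofs.formalXMulSq_formalGroupLaw_chord`, which is the case of a `p`-adically integral equation with elliptic generic fibre). [cite: SilvermanAEC2009, IV.1] -/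
theorem formalXMulSq_formalGroupLaw_chord' :
    W.formalXMulSq.subst W.formalGroupLaw *
        (W.formalXMulSq.subst (MvPowerSeries.X 0 : MvPowerSeries (Fin 2) R) *
              (MvPowerSeries.X 1 : MvPowerSeries (Fin 2) R) ^ 2 -
            W.formalXMulSq.subst (MvPowerSeries.X 1 : MvPowerSeries (Fin 2) R) *
              (MvPowerSeries.X 0 : MvPowerSeries (Fin 2) R) ^ 2) ^ 2 *
        (MvPowerSeries.X 0 : MvPowerSeries (Fin 2) R) ^ 2 *
        (MvPowerSeries.X 1 : MvPowerSeries (Fin 2) R) ^ 2 =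
      W.formalGroupLaw ^ 2 *
        ((W.formalXMulSq.subst (MvPowerSeries.X 1 : MvPowerSeries (Fin 2) R) *
                (MvPowerSeries.X 0 : MvPowerSeries (Fin 2) R) ^ 3 -
              W.formalXMulSq.subst (MvPowerSeries.X 0 : MvPowerSeries (Fin 2) R) *
                (MvPowerSeries.X 1 : MvPowerSeries (Fin 2) R) ^ 3) ^ 2 +
            MvPowerSeries.C W.a₁ *
              (W.formalXMulSq.subst (MvPowerSeries.X 1 : MvPowerSeries (Fin 2) R) *
                  (MvPowerSeries.X 0 : MvPowerSeries (Fin 2) R) ^ 3 -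
                W.formalXMulSq.subst (MvPowerSeries.X 0 : MvPowerSeries (Fin 2) R) *
                  (MvPowerSeries.X 1 : MvPowerSeries (Fin 2) R) ^ 3) *
              (W.formalXMulSq.subst (MvPowerSeries.X 0 : MvPowerSeries (Fin 2) R) *
                  (MvPowerSeries.X 1 : MvPowerSeries (Fin 2) R) ^ 2 -
                W.formalXMulSq.subst (MvPowerSeries.X 1 : MvPowerSeries (Fin 2) R) *
                  (MvPowerSeries.X 0 : MvPowerSeries (Fin 2) R) ^ 2) *
              (MvPowerSeries.X 0 : MvPowerSeries (Fin 2) R) *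
              (MvPowerSeries.X 1 : MvPowerSeries (Fin 2) R) -
          (MvPowerSeries.C W.a₂ * (MvPowerSeries.X 0 : MvPowerSeries (Fin 2) R) ^ 2 *
                (MvPowerSeries.X 1 : MvPowerSeries (Fin 2) R) ^ 2 +
              W.formalXMulSq.subst (MvPowerSeries.X 0 : MvPowerSeries (Fin 2) R) *
                (MvPowerSeries.X 1 : MvPowerSeries (Fin 2) R) ^ 2 +
              W.formalXMulSq.subst (MvPowerSeries.X 1 : MvPowerSeries (Fin 2) R) *
                (MvPowerSeries.X 0 : MvPowerSeries (Fin 2) R) ^ 2) *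
            (W.formalXMulSq.subst (MvPowerSeries.X 0 : MvPowerSeries (Fin 2) R) *
                  (MvPowerSeries.X 1 : MvPowerSeries (Fin 2) R) ^ 2 -
                W.formalXMulSq.subst (MvPowerSeries.X 1 : MvPowerSeries (Fin 2) R) *
                  (MvPowerSeries.X 0 : MvPowerSeries (Fin 2) R) ^ 2) ^ 2) := by
  have h := congrArg (MvPowerSeries.map W.universalEval) formalXMulSq_formalGroupLaw_chord_universalInt
  simp only [map_mul, map_pow, map_add, map_sub, MvPowerSeries.map_X, MvPowerSeries.map_C,
      PowerSeries.map_subst (PowerSeries.HasSubst.X _), PowerSeries.map_subst (WeierstrassCurve.hasSubst_formalGroupLaw _),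
      map_formalXMulSq, map_formalGroupLaw, universalInt_map, universalEval_a] at h
  exact h

end

/-! ### `formalXMulSq_formalGroupLaw_chordY` over every ring -/

section
variable {R : Type*} [CommRing R] (W : WeierstrassCurve R)

/-- Over `ℤ` with `Δ ≠ 0` (pull back the `ℤ_2`-identity along `ℤ ↪ ℤ_2`). [cite: SilvermanAEC2009, IV.1] -/
private theorem formalXMulSq_formalGroupLaw_chordY_int (W₀ : WeierstrassCurve ℤ) (hΔ : W₀.Δ ≠ 0) :
    (-W₀.formalXMulSq.subst W₀.formalGroupLaw +
          MvPowerSeries.C W₀.a₁ * W₀.formalXMulSq.subst W₀.formalGroupLaw * W₀.formalGroupLaw +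
          MvPowerSeries.C W₀.a₃ * W₀.formalGroupLaw ^ 3) *
        (W₀.formalXMulSq.subst (MvPowerSeries.X 0 : MvPowerSeries (Fin 2) ℤ) *
              (MvPowerSeries.X 1 : MvPowerSeries (Fin 2) ℤ) ^ 2 -
            W₀.formalXMulSq.subst (MvPowerSeries.X 1 : MvPowerSeries (Fin 2) ℤ) *
              (MvPowerSeries.X 0 : MvPowerSeries (Fin 2) ℤ) ^ 2) *
        (MvPowerSeries.X 0 : MvPowerSeries (Fin 2) ℤ) ^ 3 *
        (MvPowerSeries.X 1 : MvPowerSeries (Fin 2) ℤ) =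
      -((W₀.formalXMulSq.subst (MvPowerSeries.X 1 : MvPowerSeries (Fin 2) ℤ) *
              (MvPowerSeries.X 0 : MvPowerSeries (Fin 2) ℤ) ^ 3 -
            W₀.formalXMulSq.subst (MvPowerSeries.X 0 : MvPowerSeries (Fin 2) ℤ) *
              (MvPowerSeries.X 1 : MvPowerSeries (Fin 2) ℤ) ^ 3) *
          (W₀.formalXMulSq.subst W₀.formalGroupLaw * (MvPowerSeries.X 0 : MvPowerSeries (Fin 2) ℤ) ^ 2 -
            W₀.formalXMulSq.subst (MvPowerSeries.X 0 : MvPowerSeries (Fin 2) ℤ) * W₀.formalGroupLaw ^ 2) *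
          W₀.formalGroupLaw) +
        W₀.formalXMulSq.subst (MvPowerSeries.X 0 : MvPowerSeries (Fin 2) ℤ) *
          (W₀.formalXMulSq.subst (MvPowerSeries.X 0 : MvPowerSeries (Fin 2) ℤ) *
              (MvPowerSeries.X 1 : MvPowerSeries (Fin 2) ℤ) ^ 2 -
            W₀.formalXMulSq.subst (MvPowerSeries.X 1 : MvPowerSeries (Fin 2) ℤ) *
              (MvPowerSeries.X 0 : MvPowerSeries (Fin 2) ℤ) ^ 2) *
          W₀.formalGroupLaw ^ 3 * (MvPowerSeries.X 1 : MvPowerSeries (Fin 2) ℤ) := by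
  haveI := isElliptic_map_int_padic W₀ hΔ
  have h2 := (W₀.map (Int.castRingHom ℤ_[2])).formalXMulSq_formalGroupLaw_chordY
  apply mvPowerSeries_map_injective (σ := Fin 2) (φ := Int.castRingHom ℤ_[2]) (RingHom.injective_int _)
  simp only [map_mul, map_pow, map_add, map_sub, map_neg, MvPowerSeries.map_X, MvPowerSeries.map_C,
      PowerSeries.map_subst (PowerSeries.HasSubst.X _), PowerSeries.map_subst (WeierstrassCurve.hasSubst_formalGroupLaw _),
      map_formalXMulSq, map_formalGroupLaw, map_a₁, map_a₃] at h2 ⊢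
  exact h2

/-- The universal case. [cite: SilvermanAEC2009, IV.1] -/
private theorem formalXMulSq_formalGroupLaw_chordY_universalInt :
    (-universalInt.formalXMulSq.subst universalInt.formalGroupLaw +
          MvPowerSeries.C universalInt.a₁ * universalInt.formalXMulSq.subst universalInt.formalGroupLaw * universalInt.formalGroupLaw +
          MvPowerSeries.C universalInt.a₃ * universalInt.formalGroupLaw ^ 3) *
        (universalInt.formalXMulSq.subst (MvPowerSeries.X 0 : MvPowerSeries (Fin 2) (MvPolynomial (Fin 5) ℤ)) *
              (MvPowerSeries.X 1 : MvPowerSeries (Fin 2) (MvPolynomial (Fin 5) ℤ)) ^ 2 -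
            universalInt.formalXMulSq.subst (MvPowerSeries.X 1 : MvPowerSeries (Fin 2) (MvPolynomial (Fin 5) ℤ)) *
              (MvPowerSeries.X 0 : MvPowerSeries (Fin 2) (MvPolynomial (Fin 5) ℤ)) ^ 2) *
        (MvPowerSeries.X 0 : MvPowerSeries (Fin 2) (MvPolynomial (Fin 5) ℤ)) ^ 3 *
        (MvPowerSeries.X 1 : MvPowerSeries (Fin 2) (MvPolynomial (Fin 5) ℤ)) =
      -((universalInt.formalXMulSq.subst (MvPowerSeries.X 1 : MvPowerSeries (Fin 2) (MvPolynomial (Fin 5) ℤ)) *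
              (MvPowerSeries.X 0 : MvPowerSeries (Fin 2) (MvPolynomial (Fin 5) ℤ)) ^ 3 -
            universalInt.formalXMulSq.subst (MvPowerSeries.X 0 : MvPowerSeries (Fin 2) (MvPolynomial (Fin 5) ℤ)) *
              (MvPowerSeries.X 1 : MvPowerSeries (Fin 2) (MvPolynomial (Fin 5) ℤ)) ^ 3) *
          (universalInt.formalXMulSq.subst universalInt.formalGroupLaw * (MvPowerSeries.X 0 : MvPowerSeries (Fin 2) (MvPolynomial (Fin 5) ℤ)) ^ 2 -
            universalInt.formalXMulSq.subst (MvPowerSeries.X 0 : MvPowerSeries (Fin 2) (MvPolynomial (Fin 5) ℤ)) * universalInt.formalGroupLaw ^ 2) *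
          universalInt.formalGroupLaw) +
        universalInt.formalXMulSq.subst (MvPowerSeries.X 0 : MvPowerSeries (Fin 2) (MvPolynomial (Fin 5) ℤ)) *
          (universalInt.formalXMulSq.subst (MvPowerSeries.X 0 : MvPowerSeries (Fin 2) (MvPolynomial (Fin 5) ℤ)) *
              (MvPowerSeries.X 1 : MvPowerSeries (Fin 2) (MvPolynomial (Fin 5) ℤ)) ^ 2 -
            universalInt.formalXMulSq.subst (MvPowerSeries.X 1 : MvPowerSeries (Fin 2) (MvPolynomial (Fin 5) ℤ)) *
              (MvPowerSeries.X 0 : MvPowerSeries (Fin 2) (MvPolynomial (Fin 5) ℤ)) ^ 2) *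
          universalInt.formalGroupLaw ^ 3 * (MvPowerSeries.X 1 : MvPowerSeries (Fin 2) (MvPolynomial (Fin 5) ℤ)) := by
  rw [← sub_eq_zero]
  refine mvPowerSeries_universalInt_eq_zero _ fun a ha => ?_
  rw [map_sub, sub_eq_zero]
  have h := formalXMulSq_formalGroupLaw_chordY_int (universalInt.map (MvPolynomial.eval a)) ha
  simp only [map_mul, map_pow, map_add, map_sub, map_neg, MvPowerSeries.map_X, MvPowerSeries.map_C,
      PowerSeries.map_subst (PowerSeries.HasSubst.X _), PowerSeries.map_subst (WeierstrassCurve.hasSubst_formalGroupLaw _),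
      map_formalXMulSq, map_formalGroupLaw, map_a₁, map_a₃] at h ⊢
  exact h

/-- **`y(u +_F v)` formally, over every commutative ring** (ring-general form of `formalXMulSq_formalGroupLaw_chordY`). [cite: SilvermanAEC2009, IV.1] -/
theorem formalXMulSq_formalGroupLaw_chordY' :
    (-W.formalXMulSq.subst W.formalGroupLaw +
          MvPowerSeries.C W.a₁ * W.formalXMulSq.subst W.formalGroupLaw * W.formalGroupLaw +
          MvPowerSeries.C W.a₃ * W.formalGroupLaw ^ 3) *
        (W.formalXMulSq.subst (MvPowerSeries.X 0 : MvPowerSeries (Fin 2) R) *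
              (MvPowerSeries.X 1 : MvPowerSeries (Fin 2) R) ^ 2 -
            W.formalXMulSq.subst (MvPowerSeries.X 1 : MvPowerSeries (Fin 2) R) *
              (MvPowerSeries.X 0 : MvPowerSeries (Fin 2) R) ^ 2) *
        (MvPowerSeries.X 0 : MvPowerSeries (Fin 2) R) ^ 3 *
        (MvPowerSeries.X 1 : MvPowerSeries (Fin 2) R) =
      -((W.formalXMulSq.subst (MvPowerSeries.X 1 : MvPowerSeries (Fin 2) R) *
              (MvPowerSeries.X 0 : MvPowerSeries (Fin 2) R) ^ 3 -
            W.formalXMulSq.subst (MvPowerSeries.X 0 : MvPowerSeries (Fin 2) R) *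
              (MvPowerSeries.X 1 : MvPowerSeries (Fin 2) R) ^ 3) *
          (W.formalXMulSq.subst W.formalGroupLaw * (MvPowerSeries.X 0 : MvPowerSeries (Fin 2) R) ^ 2 -
            W.formalXMulSq.subst (MvPowerSeries.X 0 : MvPowerSeries (Fin 2) R) * W.formalGroupLaw ^ 2) *
          W.formalGroupLaw) +
        W.formalXMulSq.subst (MvPowerSeries.X 0 : MvPowerSeries (Fin 2) R) *
          (W.formalXMulSq.subst (MvPowerSeries.X 0 : MvPowerSeries (Fin 2) R) *
              (MvPowerSeries.X 1 : MvPowerSeries (Fin 2) R) ^ 2 -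
            W.formalXMulSq.subst (MvPowerSeries.X 1 : MvPowerSeries (Fin 2) R) *
              (MvPowerSeries.X 0 : MvPowerSeries (Fin 2) R) ^ 2) *
          W.formalGroupLaw ^ 3 * (MvPowerSeries.X 1 : MvPowerSeries (Fin 2) R) := by
  have h := congrArg (MvPowerSeries.map W.universalEval) formalXMulSq_formalGroupLaw_chordY_universalInt
  simp only [map_mul, map_pow, map_add, map_sub, map_neg, MvPowerSeries.map_X, MvPowerSeries.map_C,
      PowerSeries.map_subst (PowerSeries.HasSubst.X _), PowerSeries.map_subst (WeierstrassCurve.hasSubst_formalGroupLaw _),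
      map_formalXMulSq, map_formalGroupLaw, universalInt_map, universalEval_a] at h
  exact h

end

/-! ### `formalXMulSq_formalMul_two` over every ring -/

section
variable {R : Type*} [CommRing R] (W : WeierstrassCurve R)

/-- Over `ℤ` with `Δ ≠ 0` (pull back the `ℤ_2`-identity along `ℤ ↪ ℤ_2`). [cite: SilvermanAEC2009, IV.2] -/
private theorem formalXMulSq_formalMul_two_int (W₀ : WeierstrassCurve ℤ) (hΔ : W₀.Δ ≠ 0) :
    W₀.formalXMulSq.subst (W₀.formalMul 2) * X ^ 2 *
        ((C W₀.a₁ * X - 2) * W₀.formalXMulSq + C W₀.a₃ * X ^ 3) ^ 2 =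
      W₀.formalMul 2 ^ 2 *
        ((3 * W₀.formalXMulSq ^ 2 + 2 * C W₀.a₂ * X ^ 2 * W₀.formalXMulSq + C W₀.a₄ * X ^ 4 +
              C W₀.a₁ * X * W₀.formalXMulSq) ^ 2 +
            C W₀.a₁ * (3 * W₀.formalXMulSq ^ 2 + 2 * C W₀.a₂ * X ^ 2 * W₀.formalXMulSq + C W₀.a₄ * X ^ 4 +
              C W₀.a₁ * X * W₀.formalXMulSq) * X * ((C W₀.a₁ * X - 2) * W₀.formalXMulSq + C W₀.a₃ * X ^ 3) -
          C W₀.a₂ * X ^ 2 * ((C W₀.a₁ * X - 2) * W₀.formalXMulSq + C W₀.a₃ * X ^ 3) ^ 2 -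
          2 * W₀.formalXMulSq * ((C W₀.a₁ * X - 2) * W₀.formalXMulSq + C W₀.a₃ * X ^ 3) ^ 2) := by
  haveI := isElliptic_map_int_padic W₀ hΔ
  have h2 := (W₀.map (Int.castRingHom ℤ_[2])).formalXMulSq_formalMul_two
  apply powerSeries_map_injective_int2
  simp only [map_mul, map_pow, map_add, map_sub, map_ofNat, PowerSeries.map_X, PowerSeries.map_C,
      powerSeries_map_subst _ (WeierstrassCurve.hasSubst_formalMul _ 2), map_formalXMulSq, map_formalMul,
      map_a₁, map_a₂, map_a₃, map_a₄] at h2 ⊢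
  exact h2

/-- The universal case. [cite: SilvermanAEC2009, IV.2] -/
private theorem formalXMulSq_formalMul_two_universalInt :
    universalInt.formalXMulSq.subst (universalInt.formalMul 2) * X ^ 2 *
        ((C universalInt.a₁ * X - 2) * universalInt.formalXMulSq + C universalInt.a₃ * X ^ 3) ^ 2 =
      universalInt.formalMul 2 ^ 2 *
        ((3 * universalInt.formalXMulSq ^ 2 + 2 * C universalInt.a₂ * X ^ 2 * universalInt.formalXMulSq + C universalInt.a₄ * X ^ 4 +
              C universalInt.a₁ * X * universalInt.formalXMulSq) ^ 2 +
            C universalInt.a₁ * (3 * universalInt.formalXMulSq ^ 2 + 2 * C universalInt.a₂ * X ^ 2 * universalInt.formalXMulSq + C universalInt.a₄ * X ^ 4 +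
              C universalInt.a₁ * X * universalInt.formalXMulSq) * X * ((C universalInt.a₁ * X - 2) * universalInt.formalXMulSq + C universalInt.a₃ * X ^ 3) -
          C universalInt.a₂ * X ^ 2 * ((C universalInt.a₁ * X - 2) * universalInt.formalXMulSq + C universalInt.a₃ * X ^ 3) ^ 2 -
          2 * universalInt.formalXMulSq * ((C universalInt.a₁ * X - 2) * universalInt.formalXMulSq + C universalInt.a₃ * X ^ 3) ^ 2) := by
  rw [← sub_eq_zero]
  refine powerSeries_universalInt_eq_zero _ fun a ha => ?_
  rw [map_sub, sub_eq_zero]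
  have h := formalXMulSq_formalMul_two_int (universalInt.map (MvPolynomial.eval a)) ha
  simp only [map_mul, map_pow, map_add, map_sub, map_ofNat, PowerSeries.map_X, PowerSeries.map_C,
      powerSeries_map_subst _ (WeierstrassCurve.hasSubst_formalMul _ 2), map_formalXMulSq, map_formalMul,
      map_a₁, map_a₂, map_a₃, map_a₄] at h ⊢
  exact h

/-- **`x([2]t)` formally, over every commutative ring** (ring-general form of `formalXMulSq_formalMul_two`). [cite: SilvermanAEC2009, IV.2] -/
theorem formalXMulSq_formalMul_two' :
    W.formalXMulSq.subst (W.formalMul 2) * X ^ 2 *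
        ((C W.a₁ * X - 2) * W.formalXMulSq + C W.a₃ * X ^ 3) ^ 2 =
      W.formalMul 2 ^ 2 *
        ((3 * W.formalXMulSq ^ 2 + 2 * C W.a₂ * X ^ 2 * W.formalXMulSq + C W.a₄ * X ^ 4 +
              C W.a₁ * X * W.formalXMulSq) ^ 2 +
            C W.a₁ * (3 * W.formalXMulSq ^ 2 + 2 * C W.a₂ * X ^ 2 * W.formalXMulSq + C W.a₄ * X ^ 4 +
              C W.a₁ * X * W.formalXMulSq) * X * ((C W.a₁ * X - 2) * W.formalXMulSq + C W.a₃ * X ^ 3) -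
          C W.a₂ * X ^ 2 * ((C W.a₁ * X - 2) * W.formalXMulSq + C W.a₃ * X ^ 3) ^ 2 -
          2 * W.formalXMulSq * ((C W.a₁ * X - 2) * W.formalXMulSq + C W.a₃ * X ^ 3) ^ 2) := by
  have h := congrArg (PowerSeries.map W.universalEval) formalXMulSq_formalMul_two_universalInt
  simp only [map_mul, map_pow, map_add, map_sub, map_ofNat, PowerSeries.map_X, PowerSeries.map_C,
      powerSeries_map_subst _ (WeierstrassCurve.hasSubst_formalMul _ 2), map_formalXMulSq, map_formalMul,
      universalInt_map, universalEval_a] at h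
  exact h

end

/-! ### `formalXMulSq_formalMul_twoY` over every ring -/

section
variable {R : Type*} [CommRing R] (W : WeierstrassCurve R)

/-- Over `ℤ` with `Δ ≠ 0` (pull back the `ℤ_2`-identity along `ℤ ↪ ℤ_2`). [cite: SilvermanAEC2009, IV.2] -/
private theorem formalXMulSq_formalMul_twoY_int (W₀ : WeierstrassCurve ℤ) (hΔ : W₀.Δ ≠ 0) :
    (-W₀.formalXMulSq.subst (W₀.formalMul 2) +
          C W₀.a₁ * W₀.formalXMulSq.subst (W₀.formalMul 2) * W₀.formalMul 2 + C W₀.a₃ * W₀.formalMul 2 ^ 3) *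
        X ^ 3 * ((C W₀.a₁ * X - 2) * W₀.formalXMulSq + C W₀.a₃ * X ^ 3) =
      -((3 * W₀.formalXMulSq ^ 2 + 2 * C W₀.a₂ * X ^ 2 * W₀.formalXMulSq + C W₀.a₄ * X ^ 4 +
              C W₀.a₁ * X * W₀.formalXMulSq) *
          (W₀.formalXMulSq.subst (W₀.formalMul 2) * X ^ 2 - W₀.formalXMulSq * W₀.formalMul 2 ^ 2) *
          W₀.formalMul 2) +
        W₀.formalXMulSq * W₀.formalMul 2 ^ 3 * ((C W₀.a₁ * X - 2) * W₀.formalXMulSq + C W₀.a₃ * X ^ 3) := by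
  haveI := isElliptic_map_int_padic W₀ hΔ
  have h2 := (W₀.map (Int.castRingHom ℤ_[2])).formalXMulSq_formalMul_twoY
  apply powerSeries_map_injective_int2
  simp only [map_mul, map_pow, map_add, map_sub, map_neg, map_ofNat, PowerSeries.map_X, PowerSeries.map_C,
      powerSeries_map_subst _ (WeierstrassCurve.hasSubst_formalMul _ 2), map_formalXMulSq, map_formalMul,
      map_a₁, map_a₂, map_a₃, map_a₄] at h2 ⊢
  exact h2

/-- The universal case. [cite: SilvermanAEC2009, IV.2] -/
private theorem formalXMulSq_formalMul_twoY_universalInt :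
    (-universalInt.formalXMulSq.subst (universalInt.formalMul 2) +
          C universalInt.a₁ * universalInt.formalXMulSq.subst (universalInt.formalMul 2) * universalInt.formalMul 2 + C universalInt.a₃ * universalInt.formalMul 2 ^ 3) *
        X ^ 3 * ((C universalInt.a₁ * X - 2) * universalInt.formalXMulSq + C universalInt.a₃ * X ^ 3) =
      -((3 * universalInt.formalXMulSq ^ 2 + 2 * C universalInt.a₂ * X ^ 2 * universalInt.formalXMulSq + C universalInt.a₄ * X ^ 4 +
              C universalInt.a₁ * X * universalInt.formalXMulSq) *
          (universalInt.formalXMulSq.subst (universalInt.formalMul 2) * X ^ 2 - universalInt.formalXMulSq * universalInt.formalMul 2 ^ 2) *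
          universalInt.formalMul 2) +
        universalInt.formalXMulSq * universalInt.formalMul 2 ^ 3 * ((C universalInt.a₁ * X - 2) * universalInt.formalXMulSq + C universalInt.a₃ * X ^ 3) := by
  rw [← sub_eq_zero]
  refine powerSeries_universalInt_eq_zero _ fun a ha => ?_
  rw [map_sub, sub_eq_zero]
  have h := formalXMulSq_formalMul_twoY_int (universalInt.map (MvPolynomial.eval a)) ha
  simp only [map_mul, map_pow, map_add, map_sub, map_neg, map_ofNat, PowerSeries.map_X, PowerSeries.map_C,
      powerSeries_map_subst _ (WeierstrassCurve.hasSubst_formalMul _ 2), map_formalXMulSq, map_formalMul,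
      map_a₁, map_a₂, map_a₃, map_a₄] at h ⊢
  exact h

/-- **`y([2]t)` formally, over every commutative ring** (ring-general form of `formalXMulSq_formalMul_twoY`). [cite: SilvermanAEC2009, IV.2] -/
theorem formalXMulSq_formalMul_twoY' :
    (-W.formalXMulSq.subst (W.formalMul 2) +
          C W.a₁ * W.formalXMulSq.subst (W.formalMul 2) * W.formalMul 2 + C W.a₃ * W.formalMul 2 ^ 3) *
        X ^ 3 * ((C W.a₁ * X - 2) * W.formalXMulSq + C W.a₃ * X ^ 3) =
      -((3 * W.formalXMulSq ^ 2 + 2 * C W.a₂ * X ^ 2 * W.formalXMulSq + C W.a₄ * X ^ 4 +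
              C W.a₁ * X * W.formalXMulSq) *
          (W.formalXMulSq.subst (W.formalMul 2) * X ^ 2 - W.formalXMulSq * W.formalMul 2 ^ 2) *
          W.formalMul 2) +
        W.formalXMulSq * W.formalMul 2 ^ 3 * ((C W.a₁ * X - 2) * W.formalXMulSq + C W.a₃ * X ^ 3) := by
  have h := congrArg (PowerSeries.map W.universalEval) formalXMulSq_formalMul_twoY_universalInt
  simp only [map_mul, map_pow, map_add, map_sub, map_neg, map_ofNat, PowerSeries.map_X, PowerSeries.map_C,
      powerSeries_map_subst _ (WeierstrassCurve.hasSubst_formalMul _ 2), map_formalXMulSq, map_formalMul,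
      universalInt_map, universalEval_a] at h
  exact h

end

end WeierstrassCurve

end
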